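import Mathlib
import Summits.MatrixMultiplication.MatrixMultiplication.Theorems.SnSubsetDichotomyPolynomialSlackPositivity

/-!
# Splitting a cyclic triple sum along a decomposition of each array

Crux `Summit.MatrixMultiplication.MatrixMultiplication.Theses.SnSubsetDichotomy.PolynomialSlack`
(item `stmt-MatrixMultiplication-8306`), level-one programme, lead c6 ("beyond one half"). The level-one
datum of a TPP triple is the cyclic triple sum `Σ_{i,j,k} a_{ij} b_{jk} c_{ki}` of the three centred quotient
profiles. Each profile is split as `a = pa + la` into a HEAVY part (the over-weighted cells, a sparse
nonnegative array) and a LIGHT part (small in Frobenius norm by the restricted level-one inequality). This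
file is the bookkeeping of that split (`tripleSum_split_le`): telescoping
`abc - pa·pb·pc = la·b·c + pa·lb·c + pa·pb·lc` and bounding each of the three error sums by the product of
the Frobenius norms (`tripleSum_le_norms`) gives
`Σ pa pb pc ≤ Σ a b c + ‖la‖‖b‖‖c‖ + ‖pa‖‖lb‖‖c‖ + ‖pa‖‖pb‖‖lc‖`.
The cases with fewer split arrays are the instances `la = 0` (then `pa = a`) etc.
-/

namespace Summit.MatrixMultiplication.MatrixMultiplication.Theorems.PolynomialSlack

open scoped BigOperators

-- `Summit.<Summit>.<Problem>` is the tree's mandated summit-side namespace (CONVENTIONS §2); for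
-- this single-conjunct summit the two coincide, so each declaration silences `dupNamespace`.
set_option linter.dupNamespace false

variable {n : ℕ}

/-- Lower bound form of `tripleSum_le_norms`: `-‖P‖‖Q‖‖R‖ ≤ Σ_{i,j,k} P_{ij} Q_{jk} R_{ki}`. [folklore] -/
theorem neg_norms_le_tripleSum (P Q R : Fin n → Fin n → ℝ) :
    -(Real.sqrt (∑ i : Fin n, ∑ j : Fin n, P i j ^ 2) * Real.sqrt (∑ i : Fin n, ∑ j : Fin n, Q i j ^ 2) *
        Real.sqrt (∑ i : Fin n, ∑ j : Fin n, R i j ^ 2)) ≤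
      ∑ i : Fin n, ∑ j : Fin n, ∑ k : Fin n, P i j * Q j k * R k i := by
  have h := tripleSum_le_norms (fun i j => -P i j) Q R
  have e1 : ∑ i : Fin n, ∑ j : Fin n, ∑ k : Fin n, (-P i j) * Q j k * R k i =
      -(∑ i : Fin n, ∑ j : Fin n, ∑ k : Fin n, P i j * Q j k * R k i) := by
    simp only [neg_mul, Finset.sum_neg_distrib]
  have e2 : ∑ i : Fin n, ∑ j : Fin n, (-P i j) ^ 2 = ∑ i : Fin n, ∑ j : Fin n, P i j ^ 2 := by
    simp only [neg_sq]
  rw [e1, e2] at h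
  have e3 : Real.sqrt (∑ k : Fin n, ∑ i : Fin n, R k i ^ 2) = Real.sqrt (∑ i : Fin n, ∑ j : Fin n, R i j ^ 2) := rfl
  have e4 : Real.sqrt (∑ j : Fin n, ∑ k : Fin n, Q j k ^ 2) = Real.sqrt (∑ i : Fin n, ∑ j : Fin n, Q i j ^ 2) := rfl
  rw [e3, e4] at h
  linarith

/-- **Splitting the cyclic triple sum.** If `a = pa + la`, `b = pb + lb`, `c = pc + lc` entrywise then
`Σ pa·pb·pc ≤ Σ a·b·c + ‖la‖‖b‖‖c‖ + ‖pa‖‖lb‖‖c‖ + ‖pa‖‖pb‖‖lc‖` (Frobenius norms), by the telescoping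
identity `abc - pa pb pc = la b c + pa lb c + pa pb lc` and `tripleSum_le_norms` on each term. [folklore] -/
theorem tripleSum_split_le {n : ℕ} (a b c pa la pb lb pc lc : Fin n → Fin n → ℝ)
    (ha : ∀ i j, a i j = pa i j + la i j) (hb : ∀ i j, b i j = pb i j + lb i j)
    (hc : ∀ i j, c i j = pc i j + lc i j) :
    ∑ i : Fin n, ∑ j : Fin n, ∑ k : Fin n, pa i j * pb j k * pc k i ≤
      ∑ i : Fin n, ∑ j : Fin n, ∑ k : Fin n, a i j * b j k * c k i +
        Real.sqrt (∑ i : Fin n, ∑ j : Fin n, la i j ^ 2) * Real.sqrt (∑ i : Fin n, ∑ j : Fin n, b i j ^ 2) *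
            Real.sqrt (∑ i : Fin n, ∑ j : Fin n, c i j ^ 2) +
          Real.sqrt (∑ i : Fin n, ∑ j : Fin n, pa i j ^ 2) * Real.sqrt (∑ i : Fin n, ∑ j : Fin n, lb i j ^ 2) *
            Real.sqrt (∑ i : Fin n, ∑ j : Fin n, c i j ^ 2) +
          Real.sqrt (∑ i : Fin n, ∑ j : Fin n, pa i j ^ 2) * Real.sqrt (∑ i : Fin n, ∑ j : Fin n, pb i j ^ 2) *
            Real.sqrt (∑ i : Fin n, ∑ j : Fin n, lc i j ^ 2) := by
  -- the telescoping identity, summed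
  have hsplit : ∑ i : Fin n, ∑ j : Fin n, ∑ k : Fin n, a i j * b j k * c k i =
      ∑ i : Fin n, ∑ j : Fin n, ∑ k : Fin n, pa i j * pb j k * pc k i +
        ∑ i : Fin n, ∑ j : Fin n, ∑ k : Fin n, la i j * b j k * c k i +
        ∑ i : Fin n, ∑ j : Fin n, ∑ k : Fin n, pa i j * lb j k * c k i +
        ∑ i : Fin n, ∑ j : Fin n, ∑ k : Fin n, pa i j * pb j k * lc k i := by
    simp only [← Finset.sum_add_distrib]
    refine Finset.sum_congr rfl fun i _ => Finset.sum_congr rfl fun j _ => Finset.sum_congr rfl fun k _ => ?_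
    rw [ha i j, hb j k, hc k i]
    ring
  have h1 := neg_norms_le_tripleSum la b c
  have h2 := neg_norms_le_tripleSum pa lb c
  have h3 := neg_norms_le_tripleSum pa pb lc
  linarith

end Summit.MatrixMultiplication.MatrixMultiplication.Theorems.PolynomialSlack
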